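import Summits.ResolutionOfSingularities.ResolutionOfSingularities.Theorems.EquisingularLiftEquisingularLiftNatFanGameFan
import Mathlib.LinearAlgebra.CrossProduct
import Mathlib.LinearAlgebra.Matrix.DotProduct
import HarnessLib

/-!
# [OURS · L1 W4.5(b) · EL♮(3) · D-0157 DOOR 1, WIDTH row iso-w4] FAN-GAME WINNABILITY — brick 2b: NODE POINTS and NODE DIRECTIONS

res-L1-w45b-iso-w4 g0 (prover, width seat; desk WIDTH TABLE D1/D1′; referee crit-2). `--supports stmt-ResolutionOfSingularities-20148 --as helper`.
Sorry-free, fact-free. OURS; counted 0; AI kernel work, weaker than expert review; NOT a statement of any manuscript; nothing of [Hironaka2017] is used;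
resolution of singularities in characteristic `p` is NOT proved here or anywhere in this chain.
Blueprint: `L/res-L1-w45b-iso-w4/FANGAME-MEMO.md` §6 («NODES FIRST, THEN WALLS»).

## What is proved (any `n` unless stated)

* `FanGame.Indep`, `FanGame.not_indep_of_orthogonal` — THE ANNIHILATOR COUNT: on a smooth cone, two independent integer vectors cannot both be
  orthogonal to all rays but at most one (the rays form an invertible matrix: `Matrix.mulVec_injective_of_isUnit`).
* `FanGame.IsNodePoint` (three minimisers with independent differences) and ★ `FanGame.bad_of_nodePoint_rep` — PHASE-1 LEGALITY: a set of rays of a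
  smooth cone missing at most one ray and carrying a node point as a POSITIVE combination is `Bad`.
* `n = 3`: `FanGame.nodeDirs V` — the finite set of NODE DIRECTIONS (cross products `±(m₂ − m₁) × (m₃ − m₁)` over triples, pointing into the closed
  orthant, node points) and ★ `FanGame.exists_nodeDir` — every node point of the closed orthant is parallel, with positive factors, to one of them
  (`cross_cross_eq_smul_sub_smul'`).
-/

set_option linter.dupNamespace false

open Matrix

namespace Summit.ResolutionOfSingularities.ResolutionOfSingularities.Cruxes.EquisingularLiftNat.Sections

namespace FanGame

variable {n : ℕ}

/-! ### Independent pairs of integer vectors and the annihilator count on a smooth cone -/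

/-- Two integer vectors are INDEPENDENT: no non-trivial relation `a • d₂ = b • d₃`. [OURS · bookkeeping] -/
def Indep (d₂ d₃ : Ray n) : Prop := ∀ a b : ℤ, a • d₂ = b • d₃ → a = 0 ∧ b = 0

/-- An independent pair has a non-zero first member. -/
theorem Indep.ne_zero_left {d₂ d₃ : Ray n} (h : Indep d₂ d₃) : d₂ ≠ 0 := by
  intro h0
  have := (h 1 0 (by rw [h0, smul_zero, zero_smul])).1
  exact one_ne_zero this

/-- An independent pair has a non-zero second member. -/
theorem Indep.ne_zero_right {d₂ d₃ : Ray n} (h : Indep d₂ d₃) : d₃ ≠ 0 := by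
  intro h0
  have := (h 0 1 (by rw [h0, smul_zero, zero_smul])).2
  exact one_ne_zero this

/-- A vector orthogonal to every ray of a smooth cone is zero (the rays form an invertible matrix). -/
theorem eq_zero_of_dotProduct_smoothCone {σ : Finset (Ray n)} (hσ : ND.IsSmoothCone σ) {d : Ray n}
    (hd : ∀ ρ ∈ σ, ρ ⬝ᵥ d = 0) : d = 0 := by
  obtain ⟨B, hB, hdet⟩ := hσ
  have hA : IsUnit (ND.zMat B) := (Matrix.isUnit_iff_isUnit_det _).2 hdet
  apply Matrix.mulVec_injective_of_isUnit hA
  rw [Matrix.mulVec_zero]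
  ext i
  have hrow : ND.rayOf (B i) ∈ σ := by rw [hB]; exact Finset.mem_image_of_mem _ (Finset.mem_univ i)
  have := hd _ hrow
  simpa [Matrix.mulVec, ND.zMat_row] using this

/-- **The annihilator count.**  On a smooth cone `σ`, two INDEPENDENT vectors cannot both be orthogonal to all rays of a subset `S ⊆ σ` missing at
most one ray of `σ`. [OURS · L1 W4.5b · brick 2b] -/
theorem not_indep_of_orthogonal {σ S : Finset (Ray n)} (hσ : ND.IsSmoothCone σ)
    (hcodim : ∀ ρ ∈ σ, ∀ ρ' ∈ σ, ρ ∉ S → ρ' ∉ S → ρ = ρ') {d₂ d₃ : Ray n} (hind : Indep d₂ d₃)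
    (h₂ : ∀ ρ ∈ S, ρ ⬝ᵥ d₂ = 0) (h₃ : ∀ ρ ∈ S, ρ ⬝ᵥ d₃ = 0) : False := by
  classical
  by_cases hall : ∀ ρ ∈ σ, ρ ∈ S
  · exact hind.ne_zero_left (eq_zero_of_dotProduct_smoothCone hσ (fun ρ hρ => h₂ ρ (hall ρ hρ)))
  · push Not at hall
    obtain ⟨ρk, hρk, hρkS⟩ := hall
    -- `v := (ρk·d₃) d₂ - (ρk·d₂) d₃` is orthogonal to every ray of `σ`
    have hv : ∀ ρ ∈ σ, ρ ⬝ᵥ ((ρk ⬝ᵥ d₃) • d₂ - (ρk ⬝ᵥ d₂) • d₃) = 0 := by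
      intro ρ hρ
      by_cases hρS : ρ ∈ S
      · rw [dotProduct_sub, dotProduct_smul, dotProduct_smul, h₂ ρ hρS, h₃ ρ hρS]; simp
      · rw [hcodim ρ hρ ρk hρk hρS hρkS, dotProduct_sub, dotProduct_smul, dotProduct_smul]; simp [mul_comm]
    have hv0 := eq_zero_of_dotProduct_smoothCone hσ hv
    rw [sub_eq_zero] at hv0
    obtain ⟨ha, _⟩ := hind _ _ hv0
    -- hence `d₂` itself is orthogonal to all of `σ`
    have : ∀ ρ ∈ σ, ρ ⬝ᵥ d₂ = 0 := by
      intro ρ hρ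
      by_cases hρS : ρ ∈ S
      · exact h₂ ρ hρS
      · rw [hcodim ρ hρ ρk hρk hρS hρkS]
        have h := hv0
        rw [ha, zero_smul] at h
        -- `0 = (ρk·d₂) • d₃` with `d₃ ≠ 0` forces `ρk·d₂ = 0`
        obtain ⟨-, hb⟩ := hind 0 (ρk ⬝ᵥ d₂) (by rw [zero_smul]; exact h)
        exact hb
    exact hind.ne_zero_left (eq_zero_of_dotProduct_smoothCone hσ this)

/-! ### Node points -/

/-- `pair ρ m` is the dot product with the cast exponent vector. -/
theorem pair_eq_dotProduct (ρ : Ray n) (m : Fin n → ℕ) : pair ρ m = ρ ⬝ᵥ ND.rayOf m := by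
  simp only [pair, dotProduct, ND.rayOf]

/-- **NODE POINT**: a lattice point `x` at which three elements of the table minimise `⟨x, ·⟩` simultaneously, with INDEPENDENT differences (a point
where at least three full-dimensional linearity domains of the support function meet). [OURS · bookkeeping] -/
def IsNodePoint (V : Finset (Fin n → ℕ)) (x : Ray n) : Prop :=
  ∃ m₁ ∈ V, ∃ m₂ ∈ V, ∃ m₃ ∈ V, (∀ m' ∈ V, pair x m₁ ≤ pair x m') ∧ pair x m₂ = pair x m₁ ∧ pair x m₃ = pair x m₁ ∧
    Indep (ND.rayOf m₂ - ND.rayOf m₁) (ND.rayOf m₃ - ND.rayOf m₁)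

/-- `pair` of a combination of rays. -/
theorem pair_sum_smul (σ : Finset (Ray n)) (c : Ray n → ℕ) (m : Fin n → ℕ) :
    pair (∑ ρ ∈ σ, (c ρ : ℤ) • ρ) m = ∑ ρ ∈ σ, (c ρ : ℤ) * pair ρ m := by
  classical
  induction σ using Finset.induction_on with
  | empty => simp [pair]
  | insert a s ha ih => rw [Finset.sum_insert ha, Finset.sum_insert ha, pair_add, pair_smul, ih]

/-- `pair` of an `ℕ`-combination. -/
theorem pair_rep {σ : Finset (Ray n)} {c : Ray n → ℕ} {x : Ray n} (hx : Rep σ c x) (m : Fin n → ℕ) :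
    pair x m = ∑ ρ ∈ σ, (c ρ : ℤ) * pair ρ m := by
  rw [← hx, pair_sum_smul]

/-- **PHASE-1 LEGALITY.**  If a node point `x` is a POSITIVE combination of the rays of a set of rays `S` missing at most one ray
of a smooth cone `σ`, then `S` is `Bad`: a common minimiser `m₀` on `S` would agree with all three minimisers at `x` on every ray of `S` (a sum of non-negative
terms with positive weights vanishes), putting two independent differences in the annihilator of `S`. [OURS · L1 W4.5b · brick 2b] -/
theorem bad_of_nodePoint_rep {V : Finset (Fin n → ℕ)} {σ S : Finset (Ray n)} (hσ : ND.IsSmoothCone σ)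
    (hcodim : ∀ ρ ∈ σ, ∀ ρ' ∈ σ, ρ ∉ S → ρ' ∉ S → ρ = ρ') {c : Ray n → ℕ} (hpos : ∀ ρ ∈ S, 0 < c ρ) {x : Ray n}
    (hx : Rep S c x) (hnode : IsNodePoint V x) : Bad V S := by
  classical
  rintro ⟨m₀, hm₀, hmin₀⟩
  obtain ⟨m₁, hm₁, m₂, hm₂, m₃, hm₃, hmin₁, h₂₁, h₃₁, hind⟩ := hnode
  -- every minimiser at `x` agrees with `m₀` on each ray of `S`
  have agree : ∀ m ∈ V, pair x m ≤ pair x m₀ → ∀ ρ ∈ S, pair ρ m = pair ρ m₀ := by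
    intro m hm hle
    have hterm : ∀ ρ ∈ S, 0 ≤ (c ρ : ℤ) * (pair ρ m - pair ρ m₀) := fun ρ hρ =>
      mul_nonneg (by positivity) (by linarith [hmin₀ ρ hρ m hm])
    have hsum : ∑ ρ ∈ S, (c ρ : ℤ) * (pair ρ m - pair ρ m₀) ≤ 0 := by
      have := pair_rep hx m; have := pair_rep hx m₀
      rw [Finset.sum_congr rfl (fun ρ _ => mul_sub (c ρ : ℤ) (pair ρ m) (pair ρ m₀)), Finset.sum_sub_distrib]
      linarith
    have hzero := (Finset.sum_eq_zero_iff_of_nonneg hterm).1 (le_antisymm hsum (Finset.sum_nonneg hterm))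
    intro ρ hρ
    have h := hzero ρ hρ
    rcases mul_eq_zero.1 h with h | h
    · exact absurd h (by exact_mod_cast (hpos ρ hρ).ne')
    · linarith
  have hx₀ : pair x m₁ ≤ pair x m₀ := hmin₁ m₀ hm₀
  have e₁ := agree m₁ hm₁ hx₀
  have e₂ := agree m₂ hm₂ (h₂₁ ▸ hx₀)
  have e₃ := agree m₃ hm₃ (h₃₁ ▸ hx₀)
  refine not_indep_of_orthogonal hσ hcodim hind (fun ρ hρ => ?_) (fun ρ hρ => ?_)
  · rw [dotProduct_sub, ← pair_eq_dotProduct, ← pair_eq_dotProduct, e₂ ρ hρ, e₁ ρ hρ, sub_self]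
  · rw [dotProduct_sub, ← pair_eq_dotProduct, ← pair_eq_dotProduct, e₃ ρ hρ, e₁ ρ hρ, sub_self]

/-- A node point rescaled by a positive factor (on both sides) is a node point with the same minimisers. -/
theorem isNodePoint_of_smul_eq {V : Finset (Fin n → ℕ)} {y w : Ray n} {a b : ℤ} (ha : 0 < a) (hb : 0 < b) (h : a • y = b • w)
    (hy : IsNodePoint V y) : IsNodePoint V w := by
  have key : ∀ m : Fin n → ℕ, b * pair w m = a * pair y m := fun m => by
    rw [← pair_smul, ← pair_smul, h]
  obtain ⟨m₁, hm₁, m₂, hm₂, m₃, hm₃, hmin₁, h₂₁, h₃₁, hind⟩ := hy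
  refine ⟨m₁, hm₁, m₂, hm₂, m₃, hm₃, fun m' hm' => ?_, ?_, ?_, hind⟩
  · have := hmin₁ m' hm'
    have h1 := key m₁; have h2 := key m'
    nlinarith
  · have h1 := key m₁; have h2 := key m₂
    have : b * pair w m₂ = b * pair w m₁ := by rw [h1, h2, h₂₁]
    exact mul_left_cancel₀ hb.ne' this
  · have h1 := key m₁; have h3 := key m₃
    have : b * pair w m₃ = b * pair w m₁ := by rw [h1, h3, h₃₁]
    exact mul_left_cancel₀ hb.ne' this

end FanGame

/-! ### The node directions of a table in dimension three (cross products) -/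

namespace FanGame

open scoped Matrix

/-- The finite set of NODE DIRECTIONS of a table `V ⊂ ℕ³`: the cross products `±(m₂ − m₁) × (m₃ − m₁)` over triples of `V` that point into the
closed orthant and are node points.  Every node point of the closed orthant is a positive rational multiple of one of them (`exists_nodeDir`).
[OURS · bookkeeping; `n = 3` through the cross product] -/
noncomputable def nodeDirs (V : Finset (Fin 3 → ℕ)) : Finset (Ray 3) := by
  classical
  exact (((V ×ˢ V) ×ˢ V).image (fun t => (ND.rayOf t.1.2 - ND.rayOf t.1.1) ⨯₃ (ND.rayOf t.2 - ND.rayOf t.1.1)) ∪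
    ((V ×ˢ V) ×ˢ V).image (fun t => -((ND.rayOf t.1.2 - ND.rayOf t.1.1) ⨯₃ (ND.rayOf t.2 - ND.rayOf t.1.1)))).filter
    (fun w => (∀ i, 0 ≤ w i) ∧ w ≠ 0 ∧ IsNodePoint V w)

/-- Members of `nodeDirs V` point into the closed orthant, are non-zero, and are node points. -/
theorem mem_nodeDirs {V : Finset (Fin 3 → ℕ)} {w : Ray 3} (hw : w ∈ nodeDirs V) :
    (∀ i, 0 ≤ w i) ∧ w ≠ 0 ∧ IsNodePoint V w := by
  classical
  unfold nodeDirs at hw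
  exact (Finset.mem_filter.1 hw).2

/-- Parallel integer vectors in dimension three: if `y × w = 0` with `w ≠ 0`, `y ≠ 0`, then `a • y = b • w` or `a • y = b • (-w)` for some positive
integers `a, b`. -/
theorem exists_smul_eq_of_cross_eq_zero {y w : Ray 3} (h : y ⨯₃ w = 0) (hw : w ≠ 0) (hy : y ≠ 0) :
    ∃ a b : ℤ, 0 < a ∧ 0 < b ∧ (a • y = b • w ∨ a • y = b • (-w)) := by
  -- a coordinate `j` with `w j ≠ 0`; then `(w j) • y = (y j) • w`
  obtain ⟨j, hj⟩ : ∃ j, w j ≠ 0 := by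
    by_contra hno; push Not at hno; exact hw (funext hno)
  have hc : ∀ i, w j * y i = y j * w i := by
    have h0 := congr_fun h 0; have h1 := congr_fun h 1; have h2 := congr_fun h 2
    simp only [cross_apply, Matrix.cons_val_zero, Matrix.cons_val_one, Matrix.cons_val_two, Matrix.head_cons, Matrix.tail_cons,
      Pi.zero_apply] at h0 h1 h2
    intro i
    fin_cases j <;> fin_cases i <;> simp <;> linarith
  have hpar : w j • y = y j • w := by ext i; simp [hc i]
  have hyj : y j ≠ 0 := by
    intro h0
    rw [h0, zero_smul] at hpar
    exact hy ((smul_eq_zero.1 hpar).resolve_left hj)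
  rcases lt_or_gt_of_ne hj with hwj | hwj <;> rcases lt_or_gt_of_ne hyj with hyj' | hyj'
  · exact ⟨-w j, -y j, by linarith, by linarith, Or.inl (by rw [neg_smul, neg_smul, hpar])⟩
  · exact ⟨-w j, y j, by linarith, hyj', Or.inr (by rw [neg_smul, smul_neg, hpar])⟩
  · exact ⟨w j, -y j, hwj, by linarith, Or.inr (by rw [smul_neg, ← neg_smul, neg_neg, hpar])⟩
  · exact ⟨w j, y j, hwj, hyj', Or.inl hpar⟩

/-- **KEY: every node point of the closed orthant is parallel (with positive factors) to a node direction of the table.** [OURS · brick 2b] -/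
theorem exists_nodeDir {V : Finset (Fin 3 → ℕ)} {y : Ray 3} (hy : IsNodePoint V y) (hy0 : ∀ i, 0 ≤ y i) (hyne : y ≠ 0) :
    ∃ w ∈ nodeDirs V, ∃ a b : ℤ, 0 < a ∧ 0 < b ∧ a • y = b • w := by
  classical
  obtain ⟨m₁, hm₁, m₂, hm₂, m₃, hm₃, hmin₁, h₂₁, h₃₁, hind⟩ := hy
  set d₂ := ND.rayOf m₂ - ND.rayOf m₁ with hd₂
  set d₃ := ND.rayOf m₃ - ND.rayOf m₁ with hd₃
  -- `y ⊥ d₂, d₃`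
  have hy₂ : y ⬝ᵥ d₂ = 0 := by rw [hd₂, dotProduct_sub, ← pair_eq_dotProduct, ← pair_eq_dotProduct, h₂₁, sub_self]
  have hy₃ : y ⬝ᵥ d₃ = 0 := by rw [hd₃, dotProduct_sub, ← pair_eq_dotProduct, ← pair_eq_dotProduct, h₃₁, sub_self]
  -- `w₀ := d₂ × d₃ ≠ 0`
  have hw₀ : d₂ ⨯₃ d₃ ≠ 0 := by
    intro h0
    have h := cross_cross_eq_smul_sub_smul' d₃ d₂ d₃
    rw [h0, LinearMap.map_zero] at h
    have h' : (d₃ ⬝ᵥ d₃) • d₂ = (d₂ ⬝ᵥ d₃) • d₃ := by rw [eq_comm, sub_eq_zero] at h; exact h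
    obtain ⟨h33, -⟩ := hind _ _ h'
    exact hind.ne_zero_right (dotProduct_self_eq_zero.1 h33)
  -- `y ∥ w₀`
  have hpar : y ⨯₃ (d₂ ⨯₃ d₃) = 0 := by
    rw [cross_cross_eq_smul_sub_smul', hy₃, dotProduct_comm, hy₂, zero_smul, zero_smul, sub_self]
  obtain ⟨a, b, ha, hb, hab⟩ := exists_smul_eq_of_cross_eq_zero hpar hw₀ hyne
  -- the chosen sign gives a direction in the closed orthant which is again a node point
  have hmem : ∀ w : Ray 3, (w = d₂ ⨯₃ d₃ ∨ w = -(d₂ ⨯₃ d₃)) → a • y = b • w → w ∈ nodeDirs V := by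
    intro w hw h
    have hw0 : ∀ i, 0 ≤ w i := fun i => by
      have := congr_fun h i
      simp only [Pi.smul_apply, smul_eq_mul] at this
      nlinarith [hy0 i]
    have hwne : w ≠ 0 := by
      rintro rfl
      rcases hw with h' | h'
      · exact hw₀ h'.symm
      · exact hw₀ (neg_eq_zero.1 h'.symm)
    have hnode : IsNodePoint V w :=
      isNodePoint_of_smul_eq ha hb h ⟨m₁, hm₁, m₂, hm₂, m₃, hm₃, hmin₁, h₂₁, h₃₁, hind⟩
    unfold nodeDirs
    refine Finset.mem_filter.2 ⟨?_, hw0, hwne, hnode⟩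
    rcases hw with rfl | rfl
    · exact Finset.mem_union_left _ (Finset.mem_image.2 ⟨((m₁, m₂), m₃), by simp [hm₁, hm₂, hm₃], rfl⟩)
    · exact Finset.mem_union_right _ (Finset.mem_image.2 ⟨((m₁, m₂), m₃), by simp [hm₁, hm₂, hm₃], rfl⟩)
  rcases hab with h | h
  · exact ⟨_, hmem _ (Or.inl rfl) h, a, b, ha, hb, h⟩
  · exact ⟨_, hmem _ (Or.inr rfl) h, a, b, ha, hb, h⟩


end FanGame

end Summit.ResolutionOfSingularities.ResolutionOfSingularities.Cruxes.EquisingularLiftNat.Sections
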